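import Mathlib
import Literature.Analysis.UnboundedOperators.ConjugateOperatorRegularity
import Literature.Analysis.UnboundedOperators.UnitaryRepSpectralMeasure
import Literature.Analysis.UnboundedOperators.FourierSpectrumCalculus
import HarnessLib
import Summits.AtomisticToContinuum.FouriersLaw.Theorems.EmbeddedDrudeMourreMourreDissolutionLAPSpectralDictionary
import Summits.AtomisticToContinuum.FouriersLaw.Theorems.EmbeddedDrudeMourreMourreDissolutionLAPVirial

/-!
# Stub `stub_mourreThresholdLAP` — Mourre LAP infrastructure 3/4: functional/resolvent calculus

Item `stmt-AtomisticToContinuum-12594` (crux `MourreDissolution` of route `EmbeddedDrudeMourre`,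
sub-problem `FouriersLaw`), line `separable-vertex-faddeev-pair-sector`, stub S6
`stub_mourreThresholdLAP` = the limiting absorption principle of Mourre theory (ABG Thm 7.4.1 in
its gap-free `𝒞^{1,1}` form, Sahbani 1997, plus the virial theorem ABG Prop. 7.2.10) over the
tree's vocabulary (`OneParameterUnitaryGroup`, `fourierCalculus`, `HasMourreEstimateOn`,
`HamiltonianOfClassC1/C11`, `spectralMeasure`). The theorem itself is NOT in the tree; these files
(`…LAPSpectralDictionary`, `…LAPVirial`, `…LAPCalculus`, `…LAPLocalisation`) are the sorry-free
bottom of the chain (Mourre LAP infrastructure), reusable by every consumer of the abstract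
Mourre `⇒` LAP statement (e.g. route `MourreKoopmanCharges` of `HydrodynamicLimit`).

This file (part 3, over parts 1–2):

* §1 cutoffs on the spectral side: `⟪v, g(H/2π) v⟫ = ∫ g(ξ/2π) dμ_v(ξ)` (Fubini over the
  Stone–Bochner measure and Fourier inversion), Plancherel `‖g(H/2π) v‖² = ∫ |g(ξ/2π)|² dμ_v`,
  the a.e.-symbol bound `‖g(H/2π) v‖ ≤ C‖v‖` and `‖g(H/2π)‖ ≤ sup |g|`;
* §2 the resolvent `R(z) = resolventAt U z = (H - z)⁻¹`, `Im z < 0`, through the group: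
  `‖R(z)‖ ≤ 1/|Im z|`, `R(z)(iH x) = i x + i z R(z) x` and `R(z)(H - z)x = x` on `D(H)`
  (integration by parts), `G_ν(ω) = laplaceFourier U ψ ν ω = i⟪ψ, R(ω - iν)ψ⟫`, and the Borel
  transform `⟪ψ, R(z)ψ⟫ = ∫ dμ_ψ(ξ)/(ξ - z)`.
-/

noncomputable section

open MeasureTheory Complex Filter Topology Set
open scoped InnerProductSpace ComplexConjugate SchwartzMap FourierTransform ENNReal NNReal

namespace Summit.AtomisticToContinuum.FouriersLaw.Theorems.MourreDissolution

open Literature.Analysis.UnboundedOperators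
open Literature.Analysis.UnboundedOperators.UnitaryRep

variable {H : Type*} [NormedAddCommGroup H] [InnerProductSpace ℂ H] [CompleteSpace H]

/-! ## §1. Cutoffs on the spectral side: `⟪v, g(H/2π) v⟫ = ∫ g(ξ/2π) dμ_v(ξ)` -/

/-- The two-variable integrand `𝓕g(a) e^{iξa}` is integrable on `ℝ × (ℝ, μ)` for a finite `μ`.
[folklore] -/
theorem integrable_fourier_kernel_prod (μ : Measure ℝ) [IsFiniteMeasure μ] (g : 𝓢(ℝ, ℂ)) :
    Integrable (Function.uncurry fun (a ξ : ℝ) => (𝓕 g : 𝓢(ℝ, ℂ)) a * cexp (((ξ * a : ℝ) : ℂ) * I))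
      ((volume : Measure ℝ).prod μ) := by
  have h1 : Integrable (fun z : ℝ × ℝ => ‖(𝓕 g : 𝓢(ℝ, ℂ)) z.1‖ * (1 : ℝ)) ((volume : Measure ℝ).prod μ) :=
    ((𝓕 g : 𝓢(ℝ, ℂ)).integrable.norm).mul_prod (integrable_const (1 : ℝ))
  refine h1.mono' (Continuous.aestronglyMeasurable ?_) (ae_of_all _ (fun z => ?_))
  · exact ((𝓕 g : 𝓢(ℝ, ℂ)).continuous.comp continuous_fst).mul (by fun_prop)
  · change ‖(𝓕 g : 𝓢(ℝ, ℂ)) z.1 * cexp (((z.2 * z.1 : ℝ) : ℂ) * I)‖ ≤ ‖(𝓕 g : 𝓢(ℝ, ℂ)) z.1‖ * 1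
    rw [norm_mul, Complex.norm_exp]
    have h3 : ((((z.2 * z.1 : ℝ) : ℂ)) * I).re = 0 := by simp
    rw [h3, Real.exp_zero]

/-- **Spectral side of the smooth functional calculus**: `⟪v, g(H/2π) v⟫ = ∫ g(ξ/2π) dμ_v(ξ)`
(Fubini over the Stone–Bochner measure and Fourier inversion). This identifies the admissible
cutoffs of `HasMourreEstimateOn U A J a` (`supp g(·/2π) ⊆ J`) with spectral windows `ξ ∈ J` of the
measures `μ_v`, the same variable in which the Laplace–Fourier transform of §1 resonates.
[folklore] -/
theorem inner_fourierCalculus_eq_integral_specMeasure (U : OneParameterUnitaryGroup H) (g : 𝓢(ℝ, ℂ))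
    (v : H) :
    ⟪v, U.fourierCalculus g v⟫_ℂ = ∫ ξ, g (ξ / (2 * Real.pi)) ∂(specMeasure U v) := by
  rw [fourierCalculus_apply, inner_integral_smul_appReal U (𝓕 g : 𝓢(ℝ, ℂ)).integrable]
  have hint := integrable_fourier_kernel_prod (specMeasure U v) g
  calc ∫ a, (𝓕 g : 𝓢(ℝ, ℂ)) a * ⟪v, U.appReal a v⟫_ℂ
      = ∫ a, ∫ ξ, (𝓕 g : 𝓢(ℝ, ℂ)) a * cexp (((ξ * a : ℝ) : ℂ) * I) ∂(specMeasure U v) := by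
        refine integral_congr_ae (ae_of_all _ fun a => ?_)
        simp only
        rw [inner_appReal_eq_integral_specMeasure, ← integral_const_mul]
    _ = ∫ ξ, (∫ a, (𝓕 g : 𝓢(ℝ, ℂ)) a * cexp (((ξ * a : ℝ) : ℂ) * I)) ∂(specMeasure U v) :=
        integral_integral_swap hint
    _ = ∫ ξ, g (ξ / (2 * Real.pi)) ∂(specMeasure U v) :=
        integral_congr_ae (ae_of_all _ fun ξ => integral_fourier_mul_cexp g ξ)

/-- **Plancherel for the smooth functional calculus**: `‖g(H/2π) v‖² = ∫ |g(ξ/2π)|² dμ_v(ξ)`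
(adjoint/product rule of the tree, `U[𝓕g]* U[𝓕g] = U[𝓕(ḡ g)]`, and the previous lemma).
[folklore] -/
theorem norm_sq_fourierCalculus_eq_integral_specMeasure (U : OneParameterUnitaryGroup H)
    (g : 𝓢(ℝ, ℂ)) (v : H) :
    ‖U.fourierCalculus g v‖ ^ 2 = ∫ ξ, ‖g (ξ / (2 * Real.pi))‖ ^ 2 ∂(specMeasure U v) := by
  obtain ⟨gc, hgc⟩ := exists_schwartz_conj g
  have h1 : ⟪U.fourierCalculus g v, U.fourierCalculus g v⟫_ℂ =
      ⟪v, U.fourierCalculus (SchwartzMap.smulLeftCLM ℂ (gc : ℝ → ℂ) g) v⟫_ℂ := by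
    rw [fourierCalculus_apply, fourierCalculus_apply]
    exact U.inner_integral_fourier_integral_fourier hgc g v v
  have h2 : (⟪U.fourierCalculus g v, U.fourierCalculus g v⟫_ℂ).re = ‖U.fourierCalculus g v‖ ^ 2 := by
    rw [inner_self_eq_norm_sq_to_K]; norm_cast
  rw [← h2, h1, inner_fourierCalculus_eq_integral_specMeasure, ← RCLike.re_to_complex, ← integral_re]
  · refine integral_congr_ae (ae_of_all _ fun ξ => ?_)
    simp only
    rw [SchwartzMap.smulLeftCLM_apply_apply gc.hasTemperateGrowth, hgc, smul_eq_mul,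
      RCLike.re_to_complex, Complex.conj_mul', ← Complex.ofReal_pow, Complex.ofReal_re]
  · refine Integrable.of_bound
      (C := SchwartzMap.seminorm ℂ 0 0 (SchwartzMap.smulLeftCLM ℂ (gc : ℝ → ℂ) g))
      (Continuous.aestronglyMeasurable (by fun_prop)) (ae_of_all _ fun ξ => ?_)
    exact SchwartzMap.norm_le_seminorm ℂ (SchwartzMap.smulLeftCLM ℂ (gc : ℝ → ℂ) g) _

/-- A uniform bound for Schwartz functions: `‖g x‖ ≤ seminorm 0 0 g`. [folklore] -/
theorem norm_apply_le_seminorm (g : 𝓢(ℝ, ℂ)) (x : ℝ) : ‖g x‖ ≤ SchwartzMap.seminorm ℂ 0 0 g :=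
  SchwartzMap.norm_le_seminorm ℂ g x

/-- **Norm bound of the smooth functional calculus by the sup of the symbol on the spectral
support**: if `‖g(ξ/2π)‖ ≤ C` for `μ_v`-a.e. `ξ`, then `‖g(H/2π) v‖ ≤ C ‖v‖`. [folklore] -/
theorem norm_fourierCalculus_apply_le (U : OneParameterUnitaryGroup H) (g : 𝓢(ℝ, ℂ)) (v : H)
    {C : ℝ} (hC : 0 ≤ C) (hg : ∀ᵐ ξ ∂(specMeasure U v), ‖g (ξ / (2 * Real.pi))‖ ≤ C) :
    ‖U.fourierCalculus g v‖ ≤ C * ‖v‖ := by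
  have h1 : ‖U.fourierCalculus g v‖ ^ 2 ≤ (C * ‖v‖) ^ 2 := by
    rw [norm_sq_fourierCalculus_eq_integral_specMeasure]
    calc ∫ ξ, ‖g (ξ / (2 * Real.pi))‖ ^ 2 ∂(specMeasure U v)
        ≤ ∫ ξ, C ^ 2 ∂(specMeasure U v) := by
          refine integral_mono_ae ?_ (integrable_const _) ?_
          · refine Integrable.of_bound (C := (SchwartzMap.seminorm ℂ 0 0 g) ^ 2)
              (Continuous.aestronglyMeasurable (by fun_prop)) (ae_of_all _ fun ξ => ?_)
            rw [Real.norm_eq_abs, abs_of_nonneg (sq_nonneg _)]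
            exact pow_le_pow_left₀ (norm_nonneg _) (norm_apply_le_seminorm g _) 2
          · filter_upwards [hg] with ξ hξ
            exact pow_le_pow_left₀ (norm_nonneg _) hξ 2
      _ = C ^ 2 * (specMeasure U v).real univ := by
          rw [integral_const, smul_eq_mul, mul_comm]
      _ = (C * ‖v‖) ^ 2 := by rw [specMeasure_real_univ]; ring
  exact (pow_le_pow_iff_left₀ (norm_nonneg _) (by positivity) two_ne_zero).1 h1


/-- **`‖g(H/2π)‖ ≤ sup |g|`** (here with the Schwartz seminorm `‖g‖_{0,0} = sup ‖g‖`). [folklore] -/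
theorem norm_fourierCalculus_le_seminorm (U : OneParameterUnitaryGroup H) (g : 𝓢(ℝ, ℂ)) :
    ‖U.fourierCalculus g‖ ≤ SchwartzMap.seminorm ℂ 0 0 g :=
  ContinuousLinearMap.opNorm_le_bound _ (apply_nonneg _ _) fun v =>
    norm_fourierCalculus_apply_le U g v (apply_nonneg _ _)
      (ae_of_all _ fun _ => norm_apply_le_seminorm g _)

/-! ## §2. Calculus of the resolvent `(H - z)⁻¹`, `Im z < 0`, and `G_ν = i⟨ψ, R(ω - iν)ψ⟩` -/

/-- **The adjoint kernel**: `k_{z̄}(t) = conj (k_z(-t))` for non-real `z` (so that `U[k_z]* = U[k_{z̄}]`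
by `U[k]* = U[k†]`, `k†(a) = conj k(-a)`). [folklore] -/
theorem resolventKernelAt_conj {z : ℂ} (hz : z.im ≠ 0) (t : ℝ) :
    resolventKernelAt (conj z) t = conj (resolventKernelAt z (-t)) := by
  have hexp : conj (cexp (-(I * z * ((-t : ℝ) : ℂ)))) = cexp (-(I * conj z * (t : ℂ))) := by
    rw [← Complex.exp_conj]
    congr 1
    simp only [map_neg, map_mul, Complex.conj_I, Complex.conj_ofReal, Complex.ofReal_neg]
    ring
  rcases lt_or_gt_of_ne hz with h | h
  · have h' : ¬(conj z).im < 0 := by rw [Complex.conj_im]; linarith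
    simp only [resolventKernelAt, if_neg h', if_pos h, neg_nonneg]
    by_cases ht : t ≤ 0
    · rw [if_pos ht, if_pos ht, map_mul, map_neg, Complex.conj_I, neg_neg, hexp]
    · rw [if_neg ht, if_neg ht, map_zero]
  · have h' : (conj z).im < 0 := by rw [Complex.conj_im]; linarith
    have h'' : ¬z.im < 0 := not_lt.2 h.le
    simp only [resolventKernelAt, if_pos h', if_neg h'', neg_nonpos]
    by_cases ht : 0 ≤ t
    · rw [if_pos ht, if_pos ht, map_mul, Complex.conj_I, hexp]
    · rw [if_neg ht, if_neg ht, map_zero]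

/-- The resolvent kernel is integrable for `Im z > 0` (by the adjoint symmetry
`k_z(t) = conj (k_{z̄}(-t))` and the case `Im z̄ < 0`). [folklore] -/
theorem integrable_resolventKernelAt_of_pos {z : ℂ} (hz : 0 < z.im) :
    Integrable (resolventKernelAt z) := by
  have h1 : Integrable (resolventKernelAt (conj z)) :=
    integrable_resolventKernelAt (by rw [Complex.conj_im]; linarith)
  have h2 := integrable_conj_comp_neg h1
  refine h2.congr (ae_of_all _ fun t => ?_)
  have := resolventKernelAt_conj (z := conj z) (by rw [Complex.conj_im]; exact neg_ne_zero.2 hz.ne')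
    t
  rw [Complex.conj_conj] at this
  exact this.symm

/-- `(H - z)⁻¹ f = ∫ k_z(t) • U(t) f dt` for `Im z < 0`. [folklore] -/
theorem resolventAt_apply {z : ℂ} (hz : z.im < 0) (U : OneParameterUnitaryGroup H) (f : H) :
    resolventAt U z f = ∫ t, resolventKernelAt z t • U.appReal t f :=
  U.smear_apply (integrable_resolventKernelAt hz) f

/-- The resolvent as an integral over `(0, ∞)`. [folklore] -/
theorem resolventAt_apply_eq_setIntegral {z : ℂ} (hz : z.im < 0) (U : OneParameterUnitaryGroup H)
    (f : H) : resolventAt U z f = ∫ t in Set.Ioi 0, negIExpAt z t • U.appReal t f := by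
  -- adapted from `UnitaryRep.resolventNegI_apply_eq_setIntegral`
  rw [resolventAt_apply hz, ← integral_Ici_eq_integral_Ioi, ← integral_indicator measurableSet_Ici]
  congr 1
  funext t
  rw [resolventKernelAt_eq_indicator hz]
  by_cases ht : t ∈ Set.Ici (0 : ℝ) <;> simp [ht]

/-- **`‖(H - z)⁻¹‖ ≤ 1/|Im z|`** for `Im z < 0` (`‖k_z‖₁ = ∫₀^∞ e^{(Im z)t} dt = 1/(-Im z)`).
[folklore] -/
theorem norm_resolventAt_le {z : ℂ} (hz : z.im < 0) (U : OneParameterUnitaryGroup H) :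
    ‖resolventAt U z‖ ≤ 1 / (-z.im) := by
  refine (U.norm_smear_le _).trans (le_of_eq ?_)
  rw [resolventKernelAt_eq_indicator hz]
  have : (fun a => ‖(Set.Ici (0:ℝ)).indicator (negIExpAt z) a‖) =
      (Set.Ici (0:ℝ)).indicator fun a => Real.exp (z.im * a) := by
    funext a
    by_cases ha : a ∈ Set.Ici (0:ℝ) <;> simp [ha, norm_negIExpAt]
  rw [this, integral_indicator measurableSet_Ici, integral_Ici_eq_integral_Ioi]
  have h := integral_exp_mul_Ioi hz 0
  simp only [mul_zero, Real.exp_zero] at h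
  rw [h]
  ring

/-- The smeared orbit with the smooth kernel is integrable on `(0, ∞)`. [folklore] -/
theorem integrableOn_negIExpAt_smul_appReal {z : ℂ} (hz : z.im < 0) (U : OneParameterUnitaryGroup H)
    (f : H) : IntegrableOn (fun t : ℝ => negIExpAt z t • U.appReal t f) (Set.Ioi 0) := by
  refine ((U.integrable_smul_appReal (integrable_resolventKernelAt hz) f).integrableOn).congr_fun
    (fun t ht => ?_) measurableSet_Ioi
  simp only [resolventKernelAt_eq_indicator hz,
    Set.indicator_of_mem (Set.mem_Ici_of_Ioi ht : t ∈ Set.Ici (0 : ℝ))]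

/-- Exponential decay tends to zero (the form used below). [folklore] -/
theorem tendsto_exp_neg_atTop_nhds_zero_of_pos {b : ℝ} (hb : 0 < b) :
    Tendsto (fun t : ℝ => Real.exp (-b * t)) atTop (𝓝 0) := by
  have := Real.tendsto_exp_neg_atTop_nhds_zero.comp (tendsto_id.const_mul_atTop hb)
  refine this.congr fun t => ?_
  simp [neg_mul]

/-- **`(H - z)⁻¹` inverts `H - z` on the generator side**: for `x ∈ D(H)` and `Im z < 0`,
`R(z)(iH x) = i x + i z R(z) x`, where `iH = OneParameterGroup.generator` generates `e^{itH}`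
(integration by parts of `∫₀^∞ -i e^{-izt} d/dt(U(t)x) dt`; adapted from the tree's
`resolventNegI_generator`). [folklore] -/
theorem resolventAt_generator {z : ℂ} (hz : z.im < 0) (U : OneParameterUnitaryGroup H)
    (x : (OneParameterGroup.generator U.toStrongContRepresentation).domain) :
    resolventAt U z (OneParameterGroup.generator U.toStrongContRepresentation x) =
      I • (x : H) + (I * z) • resolventAt U z x := by
  set F : ℝ → H := fun t => negIExpAt z t • U.appReal t (x : H) with hF
  have hderiv : ∀ t, HasDerivAt F
      (negIExpAt z t • U.appReal t (OneParameterGroup.generator U.toStrongContRepresentation x) +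
        ((-(I * z)) * negIExpAt z t) • U.appReal t (x : H)) t := fun t =>
    (hasDerivAt_negIExpAt z t).smul (U.hasDerivAt_appReal_apply x t)
  have hcont : ContinuousWithinAt F (Set.Ici 0) 0 :=
    ((continuous_negIExpAt z).smul (U.continuous_appReal_apply _)).continuousWithinAt
  have hlim : Tendsto F atTop (𝓝 0) := by
    rw [tendsto_zero_iff_norm_tendsto_zero]
    have h : (fun t => ‖F t‖) = fun t => Real.exp (-(-z.im) * t) * ‖(x : H)‖ := by
      funext t
      simp only [hF, norm_smul, norm_negIExpAt, norm_appReal, neg_neg]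
    rw [h]
    simpa using (tendsto_exp_neg_atTop_nhds_zero_of_pos (neg_pos.2 hz)).mul_const ‖(x : H)‖
  have hint1 := integrableOn_negIExpAt_smul_appReal hz U
    (OneParameterGroup.generator U.toStrongContRepresentation x)
  have hint2 : IntegrableOn (fun t : ℝ => ((-(I * z)) * negIExpAt z t) • U.appReal t (x : H))
      (Set.Ioi 0) := by
    refine IntegrableOn.congr_fun ((integrableOn_negIExpAt_smul_appReal hz U (x : H)).smul (-(I * z)))
      (fun t _ => ?_) measurableSet_Ioi
    simp only [Pi.smul_apply, smul_smul]
  have hFTC := integral_Ioi_of_hasDerivAt_of_tendsto hcont (fun t _ => hderiv t)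
    (hint1.add hint2) hlim
  have hF0 : F 0 = (-I) • (x : H) := by
    simp [hF, negIExpAt]
  rw [integral_add hint1 hint2, hF0] at hFTC
  have hsmul : ∫ t in Set.Ioi 0, ((-(I * z)) * negIExpAt z t) • U.appReal t (x : H) =
      (-(I * z)) • ∫ t in Set.Ioi 0, negIExpAt z t • U.appReal t (x : H) := by
    rw [← integral_smul]
    congr 1
    funext t
    rw [smul_smul]
  rw [hsmul] at hFTC
  have hFTC' : (∫ t in Set.Ioi 0, negIExpAt z t •
      U.appReal t (OneParameterGroup.generator U.toStrongContRepresentation x)) +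
      (-(I * z)) • (∫ t in Set.Ioi 0, negIExpAt z t • U.appReal t (x : H)) = I • (x : H) := by
    rw [hFTC]
    simp
  rw [resolventAt_apply_eq_setIntegral hz, resolventAt_apply_eq_setIntegral hz,
    eq_sub_of_add_eq hFTC', neg_smul, sub_neg_eq_add]


/-- **`(H - z)⁻¹ (H - z) x = x` for `x ∈ D(H)`, `Im z < 0`**, with `H = U.hamiltonian = -i · generator`
the Stone Hamiltonian of `U(t) = e^{itH}`: `resolventAt U z` is the resolvent of `H` at `z`.
[folklore] -/
theorem resolventAt_hamiltonian_sub {z : ℂ} (hz : z.im < 0) (U : OneParameterUnitaryGroup H)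
    (x : U.hamiltonian.domain) :
    resolventAt U z (U.hamiltonian x - z • (x : H)) = x := by
  rw [hamiltonian_apply, map_sub, map_smul, map_smul, resolventAt_generator hz U x, smul_add,
    smul_smul, smul_smul]
  have h1 : -I * I = (1 : ℂ) := by rw [neg_mul, Complex.I_mul_I, neg_neg]
  have h2 : -I * (I * z) = z := by rw [← mul_assoc, h1, one_mul]
  rw [h1, h2, one_smul]
  abel

/-- **The Laplace–Fourier transform is a resolvent matrix element**:
`∫₀^∞ e^{-νt} e^{-iωt} ⟪ψ, U_t ψ⟫ dt = i ⟪ψ, (H - (ω - iν))⁻¹ ψ⟫` for `ν > 0`. [folklore] -/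
theorem laplaceFourier_eq_inner_resolventAt (U : OneParameterUnitaryGroup H) (ψ : H) {ν : ℝ}
    (hν : 0 < ν) (ω : ℝ) :
    laplaceFourier U ψ ν ω = I * ⟪ψ, resolventAt U ((ω : ℂ) - I * ν) ψ⟫_ℂ := by
  have hz : ((ω : ℂ) - I * ν).im < 0 := by simp [hν]
  rw [resolventAt_apply_eq_setIntegral hz,
    ← integral_inner (integrableOn_negIExpAt_smul_appReal hz U ψ), ← integral_const_mul]
  unfold laplaceFourier
  refine setIntegral_congr_fun measurableSet_Ioi (fun t _ => ?_)
  rw [inner_smul_right, ← mul_assoc]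
  congr 1
  rw [negIExpAt, ← mul_assoc, ← neg_mul_comm, neg_mul, Complex.I_mul_I, neg_neg, one_mul,
    Complex.ofReal_exp, ← Complex.exp_add]
  congr 1
  push_cast
  ring_nf
  rw [Complex.I_sq]
  ring


/-- **The Laplace–Fourier transform is a resolvent matrix element, headline form** (all binders
explicit; registered helper stub of `stub_mourreThresholdLAP`):
`∫₀^∞ e^{-νt} e^{-iωt} ⟪ψ, U_t ψ⟫ dt = i ⟪ψ, (H - (ω - iν))⁻¹ ψ⟫` for `ν > 0`. [folklore] -/
theorem laplaceFourier_eq_I_mul_inner_resolventAt :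
    ∀ (K : Type) [NormedAddCommGroup K] [InnerProductSpace ℂ K] [CompleteSpace K]
      (U : Literature.Analysis.UnboundedOperators.OneParameterUnitaryGroup K) (ψ : K) (ν ω : ℝ),
      0 < ν →
        Summit.AtomisticToContinuum.FouriersLaw.Theorems.MourreDissolution.laplaceFourier U ψ ν ω =
          Complex.I * ⟪ψ, Summit.AtomisticToContinuum.FouriersLaw.Theorems.MourreDissolution.resolventAt U
            ((ω : ℂ) - Complex.I * (ν : ℂ)) ψ⟫_ℂ := by
  intro K _ _ _ U ψ ν ω hν
  exact laplaceFourier_eq_inner_resolventAt U ψ hν ω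

/-- **Resolvent matrix elements are Borel transforms of the spectral measure**:
`⟪ψ, (H - z)⁻¹ ψ⟫ = ∫ dμ_ψ(ξ) / (ξ - z)` for `z = ω - iν`, `ν > 0`. In particular
`Im ⟪ψ, (H - z)⁻¹ψ⟫ = Im z · ∫ dμ_ψ/|ξ - z|²` has the sign of `Im z` (dissipativity). [folklore] -/
theorem inner_resolventAt_eq_integral_specMeasure (U : OneParameterUnitaryGroup H) (ψ : H) {ν : ℝ}
    (hν : 0 < ν) (ω : ℝ) :
    ⟪ψ, resolventAt U ((ω : ℂ) - I * ν) ψ⟫_ℂ =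
      ∫ ξ, 1 / ((ξ : ℂ) - ((ω : ℂ) - I * ν)) ∂(specMeasure U ψ) := by
  have h1 := laplaceFourier_eq_inner_resolventAt U ψ hν ω
  rw [laplaceFourier_eq_integral_specMeasure U ψ hν ω] at h1
  have h2 : ⟪ψ, resolventAt U ((ω : ℂ) - I * ν) ψ⟫_ℂ =
      -I * ∫ ξ, 1 / ((ν : ℂ) + I * ((ω - ξ : ℝ) : ℂ)) ∂(specMeasure U ψ) := by
    rw [h1, ← mul_assoc, neg_mul, Complex.I_mul_I, neg_neg, one_mul]
  rw [h2, ← integral_const_mul]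
  refine integral_congr_ae (ae_of_all _ fun ξ => ?_)
  have hw : (ν : ℂ) + I * ((ω - ξ : ℝ) : ℂ) = -I * ((ξ : ℂ) - ((ω : ℂ) - I * ν)) := by
    rw [Complex.ofReal_sub]; ring_nf; rw [Complex.I_sq]; ring
  simp only
  rw [hw, mul_one_div, div_mul_eq_div_div, div_self (neg_ne_zero.2 Complex.I_ne_zero)]

end Summit.AtomisticToContinuum.FouriersLaw.Theorems.MourreDissolution
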